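import Summits.CriticalPhenomena.PercolationContinuityZ3.Theorems.PercNearOneGluingNoHeavyPcintBFibFactorOrigin
import Summits.CriticalPhenomena.PercolationContinuityZ3.Theorems.PercNearOneGluingNoHeavyPcintUFibDominating
import HarnessLib

/-!
# PCINT lane, T-fibre route PHASE 3 (bond), step (4a): finite-sum tools and the weight of the bond route

Cell `prim-pcint`, seat `prim-pcint-1` (gen 13); memo `run/shared/lean/prim/pcint/T-FIBRE-ROUTE.md` (PHASE 3).
Finite-sum lemmas, no new facts, no `sorry`.

* `AdaptDom.dominance_of_factorisation₃` — the factorised-fibre dominance lemma with the `u`-integral hypothesis required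
  only on the kept part `Trest w` (the weight of the bond route carries a root factor that is not a test of the run).
* `AdaptDom.sum_pw_comp_inr` — marginalising the site blocks: a `pw`-integral of a function of the edge blocks `u ∘ inr` is
  the `pw`-integral over edge-block assignments.
* `BFib.sum_wt_blk_inr` / `sum_wt_blk_inl` — a `π_p`-integral over the block type `Blk Φ = (Φ × Φ ⊕ Φ → Bool)` of a function
  of one half of the bits is the `π_p`-integral over that half; `sum_wt_blk_meetsU` — the law of one layer read:
  `π_p(meetsU (layer bits) U) = 1 - (1-p)^{#U}`.
* `BFib.muB` — the weight of the route: the block product prior conditioned on all bits of the root block being set;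
  `sum_muB = 1`, `muB ≤ pw / p^{#(Φ×Φ ⊕ Φ)}`.
-/

noncomputable section

namespace Summit.CriticalPhenomena.PercolationContinuityZ3.Theorems.Pcint

open Finset

namespace AdaptDom

variable {V : Type*} [Fintype V] [DecidableEq V] {S : Type*} [Fintype S]

/-- **Factorised fibres dominate if their `u`-integrals do on the kept part**: as `dominance_of_factorisation₂`, with the
hypothesis `hdom` required only for the `w` satisfying `Trest w`. -/
theorem dominance_of_factorisation₃ (m : V → S → ℝ) (hm1 : ∀ v, ∑ s, m v s = 1) (hm0 : ∀ v s, 0 ≤ m v s)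
    (W : Finset V) (T : (V → S) → Prop) [DecidablePred T] (Trest : (V → S) → Prop) [DecidablePred Trest]
    (Ψ : (V → S) → (V → S) → Prop) [∀ u w, Decidable (Ψ u w)] (hfac : ∀ u w, T (mixG W u w) ↔ Trest w ∧ Ψ u w)
    (G : (V → S) → ℝ) (K : (V → S) → (V → S) → ℝ) (hG : ∀ u w, Ψ u w → G (mixG W u w) = K u w) (E : ℝ)
    (hdom : ∀ w, Trest w → (∑ u, pw m u * (if Ψ u w then 1 else 0)) * E ≤
      ∑ u, pw m u * ((if Ψ u w then 1 else 0) * K u w)) :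
    (∑ w, pw m w * (if T w then (1 : ℝ) else 0)) * E ≤ ∑ w, pw m w * ((if T w then (1 : ℝ) else 0) * G w) := by
  rw [sum_pw_mixG m hm1 W (fun w => if T w then (1 : ℝ) else 0),
    sum_pw_mixG m hm1 W (fun w => (if T w then (1 : ℝ) else 0) * G w)]
  have e1 : ∀ w, ∑ u, pw m u * (if T (mixG W u w) then (1 : ℝ) else 0) =
      (if Trest w then 1 else 0) * ∑ u, pw m u * (if Ψ u w then 1 else 0) := by
    intro w
    rw [Finset.mul_sum]
    refine Finset.sum_congr rfl fun u _ => ?_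
    by_cases h1 : Trest w
    · by_cases h2 : Ψ u w
      · rw [if_pos ((hfac u w).2 ⟨h1, h2⟩), if_pos h1, if_pos h2]; ring
      · rw [if_neg (fun h => h2 ((hfac u w).1 h).2), if_pos h1, if_neg h2]; ring
    · rw [if_neg (fun h => h1 ((hfac u w).1 h).1), if_neg h1]; ring
  have e2 : ∀ w, ∑ u, pw m u * ((if T (mixG W u w) then (1 : ℝ) else 0) * G (mixG W u w)) =
      (if Trest w then 1 else 0) * ∑ u, pw m u * ((if Ψ u w then 1 else 0) * K u w) := by
    intro w
    rw [Finset.mul_sum]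
    refine Finset.sum_congr rfl fun u _ => ?_
    by_cases h1 : Trest w
    · by_cases h2 : Ψ u w
      · rw [if_pos ((hfac u w).2 ⟨h1, h2⟩), if_pos h1, if_pos h2, hG u w h2]; ring
      · rw [if_neg (fun h => h2 ((hfac u w).1 h).2), if_pos h1, if_neg h2]; ring
    · rw [if_neg (fun h => h1 ((hfac u w).1 h).1), if_neg h1]; ring
  simp_rw [e1, e2]
  rw [Finset.sum_mul]
  refine Finset.sum_le_sum fun w _ => ?_
  have hw : 0 ≤ pw m w := pw_nonneg hm0 w
  by_cases h1 : Trest w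
  · rw [if_pos h1, one_mul, one_mul, mul_assoc]
    exact mul_le_mul_of_nonneg_left (hdom w h1) hw
  · rw [if_neg h1]; simp

/-- **Marginalising the blocks of one summand of a sum type**: for block assignments on `A ⊕ B` with a common one-block law,
the integral of a function of the `B`-blocks is the integral over `B`-block assignments. -/
theorem sum_pw_comp_inr {A B : Type*} [Fintype A] [Fintype B] [DecidableEq A] [DecidableEq B] (m : S → ℝ)
    (hm1 : ∑ s, m s = 1)
    (G : (B → S) → ℝ) :
    ∑ u : (A ⊕ B) → S, pw (fun _ => m) u * G (fun b => u (Sum.inr b)) = ∑ u' : B → S, pw (fun _ => m) u' * G u' := by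
  classical
  rw [← (Equiv.sumArrowEquivProdArrow A B S).symm.sum_comp]
  rw [Fintype.sum_prod_type]
  have hpw : ∀ (a : A → S) (b : B → S), pw (fun _ => m) ((Equiv.sumArrowEquivProdArrow A B S).symm (a, b)) =
      pw (fun (_ : A) => m) a * pw (fun (_ : B) => m) b := by
    intro a b
    unfold pw
    rw [Fintype.prod_sum_type]
    simp [Equiv.sumArrowEquivProdArrow]
  have hG : ∀ (a : A → S) (b : B → S), G (fun x => (Equiv.sumArrowEquivProdArrow A B S).symm (a, b) (Sum.inr x)) = G b := by
    intro a b; simp [Equiv.sumArrowEquivProdArrow]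
  simp_rw [hpw, hG]
  have : ∀ a : A → S, ∑ b : B → S, pw (fun (_ : A) => m) a * pw (fun (_ : B) => m) b * G b =
      pw (fun (_ : A) => m) a * ∑ b : B → S, pw (fun (_ : B) => m) b * G b := by
    intro a; rw [Finset.mul_sum]; exact Finset.sum_congr rfl fun b _ => by ring
  simp_rw [this]
  rw [← Finset.sum_mul, sum_pw (fun _ => hm1), one_mul]

end AdaptDom

namespace BFib

open AdaptDom EdgeExpl UFib Literature.Probability.Percolation Literature.Probability.LatticeModels

variable {Φ : Type*} [Fintype Φ] [DecidableEq Φ]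

/-! ### Integrals over the block type -/

/-- A `π_p`-integral over blocks of a function of the layer bits is the `π_p`-integral over layer configurations. -/
theorem sum_wt_blk_inr (p : ℝ) (f : (Φ → Bool) → ℝ) :
    ∑ s : Blk Φ, wt p s * f (fun i => s (Sum.inr i)) = ∑ h : Φ → Bool, wt p h * f h := by
  classical
  rw [← (Equiv.sumArrowEquivProdArrow (Φ × Φ) Φ Bool).symm.sum_comp, Fintype.sum_prod_type]
  have hwt : ∀ (a : Φ × Φ → Bool) (b : Φ → Bool), wt p ((Equiv.sumArrowEquivProdArrow (Φ × Φ) Φ Bool).symm (a, b)) =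
      wt p a * wt p b := by
    intro a b; unfold wt; rw [Fintype.prod_sum_type]; simp [Equiv.sumArrowEquivProdArrow]
  have hf : ∀ (a : Φ × Φ → Bool) (b : Φ → Bool),
      f (fun i => (Equiv.sumArrowEquivProdArrow (Φ × Φ) Φ Bool).symm (a, b) (Sum.inr i)) = f b := by
    intro a b; simp [Equiv.sumArrowEquivProdArrow]
  simp_rw [hwt, hf]
  have : ∀ a : Φ × Φ → Bool, ∑ b : Φ → Bool, wt p a * wt p b * f b = wt p a * ∑ b : Φ → Bool, wt p b * f b := by
    intro a; rw [Finset.mul_sum]; exact Finset.sum_congr rfl fun b _ => by ring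
  simp_rw [this]
  rw [← Finset.sum_mul, sum_wt, one_mul]

/-- A `π_p`-integral over blocks of a function of the internal bits is the `π_p`-integral over internal configurations. -/
theorem sum_wt_blk_inl (p : ℝ) (f : (Φ × Φ → Bool) → ℝ) :
    ∑ s : Blk Φ, wt p s * f (fun k => s (Sum.inl k)) = ∑ y : Φ × Φ → Bool, wt p y * f y := by
  classical
  rw [← (Equiv.sumArrowEquivProdArrow (Φ × Φ) Φ Bool).symm.sum_comp, Fintype.sum_prod_type]
  have hwt : ∀ (a : Φ × Φ → Bool) (b : Φ → Bool), wt p ((Equiv.sumArrowEquivProdArrow (Φ × Φ) Φ Bool).symm (a, b)) =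
      wt p a * wt p b := by
    intro a b; unfold wt; rw [Fintype.prod_sum_type]; simp [Equiv.sumArrowEquivProdArrow]
  have hf : ∀ (a : Φ × Φ → Bool) (b : Φ → Bool),
      f (fun k => (Equiv.sumArrowEquivProdArrow (Φ × Φ) Φ Bool).symm (a, b) (Sum.inl k)) = f a := by
    intro a b; simp [Equiv.sumArrowEquivProdArrow]
  simp_rw [hwt, hf]
  have : ∀ a : Φ × Φ → Bool, ∑ b : Φ → Bool, wt p a * wt p b * f a = wt p a * f a * ∑ b : Φ → Bool, wt p b := by
    intro a; rw [Finset.mul_sum]; exact Finset.sum_congr rfl fun b _ => by ring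
  simp_rw [this, sum_wt, mul_one]

/-- **The law of one layer read**: the `π_p`-probability that a fresh block meets `U` through its layer bits is
`1 - (1-p)^{#U}`. -/
theorem sum_wt_blk_meetsU (p : ℝ) (U : Finset Φ) :
    ∑ s ∈ univ.filter (fun s : Blk Φ => meetsU (fun i => s (Sum.inr i)) U = true), wt p s = 1 - (1 - p) ^ U.card := by
  classical
  rw [Finset.sum_filter]
  have h := sum_wt_blk_inr p (fun h => if meetsU h U = true then (1 : ℝ) else 0)
  simp only [mul_ite, mul_one, mul_zero] at h
  rw [h, ← Finset.sum_filter, sum_wt_filter_meetsU]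

/-! ### The weight of the bond route -/

variable {Λ : Finset (Site 2)} (o : ↥Λ) (p : ℝ)

/-- All bits of the root block are set (a predicate of this file, not a cited fact). -/
def RootAll (w : (↥Λ ⊕ ↥(EΛ triGraph Λ)) → Blk Φ) : Prop := ∀ k, w (Sum.inl o) k = true

/-- The all-set block. -/
def blkAll : Blk Φ := fun _ => true

omit [Fintype Φ] [DecidableEq Φ] in
/-- `RootAll w ↔ w (inl o) = blkAll`. -/
theorem rootAll_iff (w : (↥Λ ⊕ ↥(EΛ triGraph Λ)) → Blk Φ) : RootAll o w ↔ w (Sum.inl o) = blkAll := by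
  constructor
  · intro h; funext k; exact h k
  · intro h k; rw [h]; rfl

/-- **The weight of the bond route**: the block product prior `pw π_p` conditioned on all bits of the root block being set. -/
def muB (w : (↥Λ ⊕ ↥(EΛ triGraph Λ)) → Blk Φ) : ℝ :=
  pw (fun _ => wt p) w * (if w (Sum.inl o) = blkAll then 1 else 0) / wt p (blkAll : Blk Φ)

omit [DecidableEq Φ] in
/-- `π_p(blkAll) = p^{#(Φ × Φ ⊕ Φ)}`. -/
theorem wt_blkAll : wt p (blkAll : Blk Φ) = p ^ Fintype.card ((Φ × Φ) ⊕ Φ) := by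
  unfold wt blkAll bern
  simp only [if_true, prod_const, card_univ]

variable {o p}

omit [DecidableEq Φ] in
/-- `π_p(blkAll) > 0` for `p > 0`. -/
theorem wt_blkAll_pos (hp : 0 < p) : 0 < wt p (blkAll : Blk Φ) := by rw [wt_blkAll]; positivity

omit [DecidableEq Φ] in
/-- `muB ≥ 0`. -/
theorem muB_nonneg (hp0 : 0 ≤ p) (hp1 : p ≤ 1) (hp : 0 < p) (w : (↥Λ ⊕ ↥(EΛ triGraph Λ)) → Blk Φ) : 0 ≤ muB o p w :=
  div_nonneg (mul_nonneg (pw_nonneg (fun _ s => wt_nonneg hp0 hp1 s) w) (by split_ifs <;> norm_num))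
    (wt_blkAll_pos hp).le

/-- `muB` is a probability. -/
theorem sum_muB (hp : 0 < p) : ∑ w : (↥Λ ⊕ ↥(EΛ triGraph Λ)) → Blk Φ, muB o p w = 1 := by
  classical
  unfold muB
  rw [← Finset.sum_div]
  have h := sum_pw_mul_blind (fun (_ : ↥Λ ⊕ ↥(EΛ triGraph Λ)) => wt p) (fun _ => sum_wt p) (Sum.inl o)
    (fun x => if x = (blkAll : Blk Φ) then (1 : ℝ) else 0) (fun _ => 1) (fun _ _ => rfl)
  simp only [mul_one] at h
  rw [h, sum_pw (fun _ => sum_wt p), mul_one]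
  have : ∑ x : Blk Φ, wt p x * (if x = blkAll then (1 : ℝ) else 0) = wt p (blkAll : Blk Φ) := by
    rw [Finset.sum_eq_single (blkAll : Blk Φ) (fun x _ hx => by rw [if_neg hx, mul_zero]) (by simp)]; simp
  rw [this, div_self (wt_blkAll_pos hp).ne']

omit [DecidableEq Φ] in
/-- `muB ≤ pw / π_p(blkAll)`. -/
theorem muB_le_pw (hp0 : 0 ≤ p) (hp1 : p ≤ 1) (hp : 0 < p) (w : (↥Λ ⊕ ↥(EΛ triGraph Λ)) → Blk Φ) :
    muB o p w ≤ pw (fun _ => wt p) w / wt p (blkAll : Blk Φ) := by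
  unfold muB
  refine div_le_div_of_nonneg_right ?_ (wt_blkAll_pos hp).le
  have h0 : 0 ≤ pw (fun _ => wt p) w := pw_nonneg (fun _ s => wt_nonneg hp0 hp1 s) w
  split_ifs <;> nlinarith

omit [DecidableEq Φ] in
/-- Under `RootAll`, the root usable set is `Φ`. -/
theorem rootU_of_rootAll {w : (↥Λ ⊕ ↥(EΛ triGraph Λ)) → Blk Φ} (h : RootAll o w) : rootU o w = univ := by
  unfold RootAll at h; unfold rootU; exact if_pos h

end BFib

end Summit.CriticalPhenomena.PercolationContinuityZ3.Theorems.Pcint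

end
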